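import Literature.AlgebraicGeometry.AbelianSchemes.RigidifiedLineBundleLimitDescentStage
import HarnessLib

/-!
# A rigidified `Pic⁰` datum on `A_{Spec R}` descends to a finitely generated subalgebra — RING BASE `Spec K`

Topic: `Literature/AlgebraicGeometry/AbelianSchemes`, namespace `Literature.AlgebraicGeometry.AbelianSchemes.AbelianSchemeOver`.
THEOREMS ONLY (no definition, no named fact, no instance, no notation, no `sorry`).

This is the RING-BASE edition of ★ `AbelianSchemes/RigidifiedLineBundleLimitDescentStage` (same statements, same proofs,
`[Field K]` relaxed to `[CommRing K]`): Noetherian approximation `Spec R = lim Spec K[t]` ([EGAIV3] 8.5.2 / 8.8.2,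
[GortzWedhorn2020] Thm. 10.57 / 10.60, (10.13)) for the test data of [MumfordAV1970] §13 over an abelian scheme `A → Spec K`,
`K` ANY commutative ring (the engine ★ `Limits/SubalgebraDiagram` — `SubalgApprox` — is typed for any ring; the field entered the
★ edition only nominally).  For any `K`-algebra `R` and a rigidified line bundle `ℒ` on `A_{Spec R}`:

* §1 junctions: the legs / transition maps of ★ `SubalgApprox.prodCone K R s₁ A.X` ARE the `1_A × w` of ★
  `AbelianSchemes/PoincareUniversalLocality` (`prodCone_π_app_eq_prodMap_ringBase`, `prodDiagram_map_eq_prodMap_ringBase`);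
* §2 the base diagram `Spec K[t]`: affine transition maps, quasi-compact quasi-separated stages, stages of finite type over `K`;
* §3 **`exists_stage_rigidifiedLineBundle_ringBase`** — `ℒ` comes, AS A RIGIDIFIED LINE BUNDLE, from `A_{Spec K[t]}` for some
  finite `t ⊆ R` (Stacks 0B8W (1) ★ `Limits/FiniteLocallyFreeSubalgebraDescent`; rank one by dominance ★
  `Limits.hasRank_of_hasRank_pullback_of_denseRange`; the rigidification descends to a deeper stage, Stacks 01ZR ★
  `Limits.FiniteLocallyFreeIsoDescent.exists_stage_iso_of_pullback_iso`);
* §4 **`fibrewisePicZero_stage_ringBase`** — the descended bundle is fibrewise in `Pic⁰` whenever `ℒ` is and the `Pic⁰` locus over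
  the stage is closed (★ `FibrewisePicZero.of_denseRange_of_isClosed` with the dominance ★ `SubalgApprox.denseRange_baseCone_π_app`).

Consumer: the ring-base limit descent ★-to-be `AbelianSchemes/RigidifiedLineBundleLimitDescentRingBase` and the F-3 (Mc) node N0′
«affine finite type ⇒ all» over a Noetherian affine base (cell `hodgecm-mathlib`, D-0151, FLOOR 0 P1, grandchild line
`Cruxes/HDel/Lines/F3DualAbelianSchemeMc`, stub `stub_McN0`).  Count-neutral; HC_CM is proved only modulo the 7 printed citations
until rung 0 closes; nothing here is about HC.

Mathlib searched (pin): `Mathlib.AlgebraicGeometry.AffineTransitionLimit` (through ★ `SubalgApprox`); nothing on abelian schemes.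

## References
* [MumfordAV1970] D. Mumford, *Abelian Varieties* (1970), §13 (proof of the Thm. p. 125), §8 ((iv) ⇔ (i)).
* [EGAIV3] A. Grothendieck, J. Dieudonné, EGA IV₃ (1966), Thm. 8.5.2, Thm. 8.8.2.
* [StacksProject] The Stacks Project, Tags 0B8W (1), 01ZR (2)–(3), 00FL.
* [GortzWedhorn2020] U. Görtz, T. Wedhorn, *Algebraic Geometry I*, 2nd ed. (2020), Thm. 10.57, Thm. 10.60, (10.13), Section (4.7).
* [MilneAV2008] J. S. Milne, *Abelian Varieties* (2008), I §8 pp. 36–37.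
-/

universe u

open CategoryTheory CategoryTheory.Limits AlgebraicGeometry MonoidalCategory

namespace Literature.AlgebraicGeometry.AbelianSchemes

open Literature.AlgebraicGeometry.Motives Literature.AlgebraicGeometry.AbelianVarieties
  Literature.AlgebraicGeometry.Modules Literature.AlgebraicGeometry.Limits
  Literature.AlgebraicGeometry.Limits.SubalgApprox

set_option backward.isDefEq.respectTransparency false

namespace AbelianSchemeOver

section LimitDescentRingBase

/-! ### §1 Carrier junctions over a ring base: `SubalgApprox.prodCone` legs ARE `prodMap` -/

/-- **The legs of `prodCone` are `1_A × (Spec R → Spec K[t])`** — ring base `Spec K`.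
[cite: GortzWedhorn2020, Section (4.7) (pp. 107–108)] -/
theorem prodCone_π_app_eq_prodMap_ringBase {K : Type u} [CommRing K] (A : AbelianSchemeOver (Spec (.of K)))
    (R : Type u) [CommRing R] [Algebra K R] (s₁ : Finset R) (t : (Idx R s₁)ᵒᵖ) :
    (prodCone K R s₁ A.X).π.app t =
      A.prodMap (specOver K R).hom ((baseDiagram K R s₁).obj t).hom ((baseCone K R s₁).π.app t).left
        (Over.w _) := by
  apply pullback.hom_ext
  · rw [prodMap_fst]; exact prodCone_π_app_fst K R s₁ A.X t
  · rw [prodMap_snd]; exact prodCone_π_app_snd K R s₁ A.X t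

/-- **The transition maps of `prodDiagram` are `1_A × (Spec K[t'] → Spec K[t])`** — ring base `Spec K`.
[cite: GortzWedhorn2020, Section (4.7) (pp. 107–108)] -/
theorem prodDiagram_map_eq_prodMap_ringBase {K : Type u} [CommRing K] (A : AbelianSchemeOver (Spec (.of K)))
    (R : Type u) [CommRing R] [Algebra K R] (s₁ : Finset R) {t t' : (Idx R s₁)ᵒᵖ} (φ : t ⟶ t') :
    (prodDiagram K R s₁ A.X).map φ =
      A.prodMap ((baseDiagram K R s₁).obj t).hom ((baseDiagram K R s₁).obj t').hom
        ((baseDiagram K R s₁).map φ).left (Over.w _) := by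
  apply pullback.hom_ext
  · rw [prodMap_fst]; exact prodDiagram_map_fst K R s₁ A.X φ
  · rw [prodMap_snd]; exact prodDiagram_map_snd K R s₁ A.X φ

/-! ### §2 The base diagram `Spec K[t]` in `Scheme` and its instances over a ring base -/

/-- The transition maps `Spec K[t'] → Spec K[t]` of the base diagram are affine (a projective system of affine schemes,
Görtz–Wedhorn I (10.13) 1.) — ring base. [cite: GortzWedhorn2020, (10.13) (pp. 261–262)] -/
theorem isAffineHom_baseDiagram_forget_map_ringBase {K : Type u} [CommRing K] (R : Type u) [CommRing R] [Algebra K R]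
    (s₁ : Finset R) {t t' : (Idx R s₁)ᵒᵖ} (φ : t ⟶ t') :
    IsAffineHom ((baseDiagram K R s₁ ⋙ Over.forget _).map φ) :=
  inferInstanceAs (IsAffineHom ((baseDiagram K R s₁).map φ).left)

/-- The stages `Spec K[t]` are quasi-compact (affine) — ring base. [cite: GortzWedhorn2020, (10.13) (pp. 261–262)] -/
theorem compactSpace_baseDiagram_forget_obj_ringBase {K : Type u} [CommRing K] (R : Type u) [CommRing R] [Algebra K R]
    (s₁ : Finset R) (t : (Idx R s₁)ᵒᵖ) :
    CompactSpace ((baseDiagram K R s₁ ⋙ Over.forget _).obj t) :=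
  inferInstanceAs (CompactSpace ((baseDiagram K R s₁).obj t).left)

/-- The stages `Spec K[t]` are quasi-separated (affine) — ring base. [cite: GortzWedhorn2020, (10.13) (pp. 261–262)] -/
theorem quasiSeparatedSpace_baseDiagram_forget_obj_ringBase {K : Type u} [CommRing K] (R : Type u) [CommRing R] [Algebra K R]
    (s₁ : Finset R) (t : (Idx R s₁)ᵒᵖ) :
    QuasiSeparatedSpace ((baseDiagram K R s₁ ⋙ Over.forget _).obj t) :=
  inferInstanceAs (QuasiSeparatedSpace ((baseDiagram K R s₁).obj t).left)

/-- The stages `Spec K[t] → Spec K` are of finite type (`K[t]` a finitely generated `K`-subalgebra; Görtz–Wedhorn I (10.13)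
with Prop. 10.5) — ring base. [cite: GortzWedhorn2020, (10.13) (pp. 261–262)] -/
theorem locallyOfFiniteType_baseDiagram_obj_hom_ringBase {K : Type u} [CommRing K] (R : Type u) [CommRing R] [Algebra K R]
    (s₁ : Finset R) (t : (Idx R s₁)ᵒᵖ) :
    LocallyOfFiniteType ((baseDiagram K R s₁).obj t).hom := by
  change LocallyOfFiniteType (Spec.map (CommRingCat.ofHom (algebraMap K (sub K R t.unop.1))))
  rw [HasRingHomProperty.Spec_iff (P := @LocallyOfFiniteType)]
  exact RingHom.finiteType_algebraMap.mpr inferInstance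

/-! ### §3 The test datum descends to a stage AS A RIGIDIFIED LINE BUNDLE — ring base -/

/-- **A rigidified line bundle on `A_{Spec R}` comes, as a RIGIDIFIED LINE BUNDLE, from some `A_{Spec K[t]}`**
(`K[t] ⊆ R` finitely generated; `K` any commutative ring): the module descends (★ Stacks 0B8W (1)), has rank one there (dominance
of `A × Spec R → A × Spec K[t]`, ★ `hasRank_of_hasRank_pullback_of_denseRange`), and its rigidification descends to a deeper stage
(isomorphisms descend, ★ `exists_stage_iso_of_pullback_iso` on the base diagram).  Ring-base edition of ★
`exists_stage_rigidifiedLineBundle`. [cite: StacksProject, Tag 0B8W (Lemma 32.10.3 (1)–(2)) and Tag 01ZR (Lemma 32.10.2)]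
[cite: MumfordAV1970, §13 (proof of the Thm. p. 125)] -/
theorem exists_stage_rigidifiedLineBundle_ringBase {K : Type u} [CommRing K] {A : AbelianSchemeOver (Spec (.of K))}
    {R : Type u} [CommRing R] [Algebra K R] (ℒ : A.RigidifiedLineBundle (specOver K R).hom) :
    ∃ (t : (Idx R (∅ : Finset R))ᵒᵖ) (ℒt : A.RigidifiedLineBundle ((baseDiagram K R ∅).obj t).hom),
      Nonempty (ℒ.L ≅ (Scheme.Modules.pullback ((prodCone K R ∅ A.X).π.app t)).obj ℒt.L) := by
  classical
  haveI := A.isProper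
  haveI := A.isSmooth
  haveI : UniversallyOpen A.X.hom := A.universallyOpen_hom
  -- Step 1: the module descends (★ Stacks 0B8W (1))
  obtain ⟨t, ℰ, hℰ, ⟨eℰ⟩⟩ := exists_isFiniteLocallyFree_pullback_iso_subalgebra K R ∅ A.X
    (E := (ℒ.L : (prodCone K R ∅ A.X).pt.Modules)) (HasRank.isFiniteLocallyFree' ℒ.hasRank_one)
  -- Step 2: rank one on the whole stage
  have hℰ1 : HasRank ℰ 1 :=
    hasRank_of_hasRank_pullback_of_denseRange _ (denseRange_prodCone_π_app K R ∅ A.X t) hℰ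
      (hasRank_of_iso eℰ.symm ℒ.hasRank_one)
  -- the stage and its unit section
  let Tt : SchemeOver K := (baseDiagram K R ∅).obj t
  let εt : Tt.left ⟶ (prodDiagram K R ∅ A.X).obj t := (A.baseChange Tt.hom).unitSection
  let wt : (specOver K R).left ⟶ Tt.left := ((baseCone K R ∅).π.app t).left
  have J1 : wt ≫ εt = (A.baseChange (specOver K R).hom).unitSection ≫ (prodCone K R ∅ A.X).π.app t := by
    rw [prodCone_π_app_eq_prodMap_ringBase, unitSection_comp_prodMap]
  -- the rigidification, pulled back to `Spec R`: `wt^* εt^* ℰ ≅ εR^* πt^* ℰ ≅ εR^* ℒ.L ≅ 𝒪 ≅ wt^* 𝒪`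
  have φ : (Scheme.Modules.pullback wt).obj ((Scheme.Modules.pullback εt).obj ℰ) ≅
      (Scheme.Modules.pullback wt).obj (SheafOfModules.unit _) :=
    (Scheme.Modules.pullbackComp wt εt).app ℰ ≪≫
      (Scheme.Modules.pullbackCongr J1).app ℰ ≪≫
      ((Scheme.Modules.pullbackComp _ _).app ℰ).symm ≪≫
      (Scheme.Modules.pullback _).mapIso eℰ ≪≫ ℒ.rigid.some ≪≫
      (RigidifiedLineBundle.pullbackUnitIso wt).symm
  -- Step 3: this isomorphism descends along the base diagram `Spec K[t'] → Spec K[t]`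
  haveI : ∀ {t₁ t₂ : (Idx R (∅ : Finset R))ᵒᵖ} (φ : t₁ ⟶ t₂),
      IsAffineHom ((baseDiagram K R ∅ ⋙ Over.forget _).map φ) :=
    fun φ => isAffineHom_baseDiagram_forget_map_ringBase R ∅ φ
  haveI : ∀ t₁ : (Idx R (∅ : Finset R))ᵒᵖ, CompactSpace ((baseDiagram K R ∅ ⋙ Over.forget _).obj t₁) :=
    fun t₁ => compactSpace_baseDiagram_forget_obj_ringBase R ∅ t₁
  haveI : ∀ t₁ : (Idx R (∅ : Finset R))ᵒᵖ, QuasiSeparatedSpace ((baseDiagram K R ∅ ⋙ Over.forget _).obj t₁) :=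
    fun t₁ => quasiSeparatedSpace_baseDiagram_forget_obj_ringBase R ∅ t₁
  obtain ⟨t', g, ⟨ψ⟩⟩ := FiniteLocallyFreeIsoDescent.exists_stage_iso_of_pullback_iso
    (baseDiagram K R ∅ ⋙ Over.forget _) ((Over.forget _).mapCone (baseCone K R ∅))
    (isLimitForgetBaseCone K R ∅) (i := t) (HasRank.isFiniteLocallyFree' (hasRank_pullback εt hℰ1))
    (HasRank.isFiniteLocallyFree' (hasRank_unit_one (X := Tt.left))) φ
  -- Step 4: the stage `t'` and the descended rigidified line bundle there
  let Tt' : SchemeOver K := (baseDiagram K R ∅).obj t'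
  let g' : Tt' ⟶ Tt := (baseDiagram K R ∅).map g
  let ℰ' : ((prodDiagram K R ∅ A.X).obj t').Modules := (Scheme.Modules.pullback ((prodDiagram K R ∅ A.X).map g)).obj ℰ
  let εt' : Tt'.left ⟶ (prodDiagram K R ∅ A.X).obj t' := (A.baseChange Tt'.hom).unitSection
  have J2 : εt' ≫ (prodDiagram K R ∅ A.X).map g = g'.left ≫ εt := by
    simp only [εt', εt]
    rw [prodDiagram_map_eq_prodMap_ringBase, unitSection_comp_prodMap]
  have rigid' : Nonempty ((Scheme.Modules.pullback εt').obj ℰ' ≅ SheafOfModules.unit _) :=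
    ⟨(Scheme.Modules.pullbackComp εt' _).app ℰ ≪≫
      (Scheme.Modules.pullbackCongr J2).app ℰ ≪≫
      ((Scheme.Modules.pullbackComp _ _).app ℰ).symm ≪≫ ψ ≪≫
      RigidifiedLineBundle.pullbackUnitIso g'.left⟩
  refine ⟨t', ⟨ℰ', hasRank_pullback _ hℰ1, rigid'⟩, ⟨?_⟩⟩
  -- `ℒ.L ≅ π_t^* ℰ ≅ (π_{t'} ≫ D g)^* ℰ ≅ π_{t'}^* ℰ'`
  exact eℰ.symm ≪≫ (Scheme.Modules.pullbackCongr ((prodCone K R ∅ A.X).w g).symm).app ℰ ≪≫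
    ((Scheme.Modules.pullbackComp _ _).app ℰ).symm

/-! ### §4 The descended bundle is fibrewise in `Pic⁰` — ring base -/

/-- **The descended rigidified line bundle on `A_{Spec K[t]}` is fibrewise in `Pic⁰`** if the datum on `A_{Spec R}` is
(`K` any commutative ring): its `Pic⁰` locus is closed (hypothesis `hclosed`) and contains the dense image of `Spec R → Spec K[t]`
(★ `FibrewisePicZero.of_denseRange_of_isClosed`, ★ `SubalgApprox.denseRange_baseCone_π_app`).  Ring-base edition of ★
`fibrewisePicZero_stage`. [cite: MumfordAV1970, §8 ((iv) ⇔ (i)), §10 (seesaw, p. 89)] [cite: StacksProject, Tag 00FL] -/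
theorem fibrewisePicZero_stage_ringBase {K : Type u} [CommRing K] {A : AbelianSchemeOver (Spec (.of K))}
    {R : Type u} [CommRing R] [Algebra K R] 
    (hclosed : ∀ (T : Scheme.{u}) [IsAffine T] (f : T ⟶ Spec (.of K)) [LocallyOfFiniteType f]
      (ℒ : A.RigidifiedLineBundle f), IsClosed ℒ.picZeroLocus)
    {t : (Idx R (∅ : Finset R))ᵒᵖ} (ℒ : A.RigidifiedLineBundle (specOver K R).hom) (hℒ : ℒ.FibrewisePicZero)
    (ℒt : A.RigidifiedLineBundle ((baseDiagram K R ∅).obj t).hom)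
    (e : ℒ.L ≅ (Scheme.Modules.pullback ((prodCone K R ∅ A.X).π.app t)).obj ℒt.L) : ℒt.FibrewisePicZero := by
  haveI : LocallyOfFiniteType ((baseDiagram K R ∅).obj t).hom := locallyOfFiniteType_baseDiagram_obj_hom_ringBase R ∅ t
  refine RigidifiedLineBundle.FibrewisePicZero.of_denseRange_of_isClosed ℒt (hclosed _ _ ℒt)
    ((baseCone K R ∅).π.app t).left (denseRange_baseCone_π_app K R ∅ t) fun Ω _ _ t₁ => ?_
  -- `ℒ.L ≅ (1 × w)^* ℒt.L = (ℒt.comapAlong w _).L`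
  have e' : ℒ.L ≅ (ℒt.comapAlong ((baseCone K R ∅).π.app t).left (Over.w _)).L :=
    e ≪≫ (Scheme.Modules.pullbackCongr (A.prodCone_π_app_eq_prodMap_ringBase R ∅ t)).app ℒt.L
  exact (ℒt.isHomogeneous_fibre_comapAlong_iff _ (Over.w _) Ω t₁).1
    ((RigidifiedLineBundle.isHomogeneous_fibre_iff_of_iso ℒ _ e' Ω t₁).1 (hℒ Ω t₁))

end LimitDescentRingBase

end AbelianSchemeOver

end Literature.AlgebraicGeometry.AbelianSchemes
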